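/-
Copyright (c) 2026 the pub-hodgecm-mathlib formalisation cell (harness21).  Prover seat hodgecm-mathlib-LH4-p16 (g2), req620 Track A «(D-RAM) FOUR-FRAME» squad
(STAGE-1b, row (2) of the piece `f_{T₊}`, the (β₂) road (R-36); β₂ sub-dealer LH4-p04 (g9) «OFF-ROW ZERO + ROW», lane-C hinge LH7-p10 (g2); MECH-K2 v1 §4
«(ROW-INT)_C»: K5-C, first file), 2026-09-04.
-/
import Summits.HodgeConjecture.HodgeConjecture.Theorems.F0P3cDyRamRowVertexAffineCoordinate   -- ★ p862871 (this seat): the coordinate `D₀⁻¹·(jE pw)⁻¹ = κ₀ + jE(V)·ξ₀`, `rayScalar_eq_affine`; brings ★ DEFS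
import HarnessLib

/-!
# Crux `H413`, line LH4 «(D-RAM) FOUR-FRAME» — STAGE-1b, row (2), the (β₂) road (R-36), lane C, (ROW-INT)_C, K5-C (1): «HOW THE COORDINATE OF A ROW VERTEX MOVES WITH ITS
# GENERATOR» — the exact change of `κ̂ = w∕Tr_ρ w` under `w ↦ w·u`, generator independence of the digit, and the transport multiplier to a prescribed digit

Cell `hodgecm-mathlib` (D-0151), FLOOR 0, crux item H413 = `stmt-HodgeConjecture-24833`, route of record `HCCMUnconditional`; squad F0∕P3c∕LH4; lane
`--supports stmt-HodgeConjecture-24833 --as helper` (count-neutral; pays NO tier-0 row).  THEOREMS ONLY (no `def`, no instance, no notation, no `sorry`, default heartbeats);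
★-only imports; states NO law; (β₂) stays a HYPOTHESIS.  DATUM-FREE `M`-letters (`ρ`, `Θ` commuting; `jE : E → M`; ★ DEFS `dualGen`, `IsOrd`).
WHY (MECH-K2 v1 `F0/P3c/LH4/LH4-p16/g2/MECH-K2.v1.LH4p16g2.md` §4; ★ p862871; LH4-p19 (g2)'s lane-B twins ★ `…DiagonalCellGeneratorChange` ∕ `…FibreTransport` ∕
`…GeneratorIndependence`).  By ★ p862871 a vertex `Λ = x₀·𝒪_cc` of a row cell carries the doubly-fixed coordinate `V(Λ)`: `κ̂ := D₀⁻¹·(jE pw)⁻¹ = w∕Tr_ρ w = κ₀ + jE(V)·ξ₀`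
(`w = D₀⁻¹`, `D₀ = cc(α − ρα)·ΘY`, `Y = dualGen ρ Θ α cc h x₀`), and by ★ p862927 ∕ ★ p863048 its label is `ω(T)·ω(α₁ + γ₁·V(Λ))`.  (ROW-INT)_C needs the RANGE and the
MULTIPLICITIES of `V` over a cell (K5-C) — and first how `V` moves when the generator moves: `x₀ ↦ e·x₀` multiplies `Y` and `D₀` by the `Θ`-norm `eΘe` (§1), i.e. `w ↦ w·u`,
`u = (eΘe)⁻¹ ∈ Fix Θ`.  THIS FILE:
* §1 `dualGen_mul_gen`, `cellScalar_mul_gen` (`Y`, `D₀` scale by `eΘe`); the skew of a `Θ`-norm, `N_Θζ − ρN_Θζ = (ζ − ρζ)Θζ + ρζ·Θ(ζ − ρζ)`, so `|N_Θζ − ρN_Θζ| ≤ |ζ − ρζ|·|ζ|`;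
* §2 THE EXACT CHANGE `wu∕Tr_ρ(wu) − w∕Tr_ρ w = w·ρw·(u − ρu)∕(Tr_ρ w·Tr_ρ(wu))` (`div_trace_mul_sub_div_trace`) — the coordinate moves by the SKEW of the multiplier, damped by the
  two traces — hence `jE(V′ − V)·ξ₀ = w·ρw·(u − ρu)∕(Tr_ρ w·Tr_ρ(wu))` (`map_sub_mul_anti_eq`) and its valuation;
* §3 GENERATOR INDEPENDENCE: for an order unit `ζ ∈ 𝒪_cc^×` (same lattice) `|jE(V′ − V)|·|ξ₀| ≤ |w|²·|cc(α − ρα)|∕(|Tr_ρ w|·|Tr_ρ(wu)|)` (`v_map_sub_mul_le_of_orderUnit`) — in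
  tokens `|jEϖ|^{b}` below the range of `V·ξ₀`, so the digit of `V(Λ)` does not depend on the generator;
* §4 TRANSPORT: a point `κ₀ + jE(V₂)ξ₀` of the line has ρ-trace `1` (`trace_affinePoint_eq_one`), `(κ·c)∕Tr_ρ(κ·c) = κ` for `Tr_ρ κ = 1`, `ρc = c ≠ 0` (`div_trace_eq_of_trace_one`),
  so the multiplier `u := (κ₀ + jE V₂ ξ₀)·c∕w` lands EXACTLY on the digit `V₂` (`div_trace_transport_eq`); whether `u⁻¹` is a `Θ`-norm `eΘe` (so that `e·x₀` realises it inside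
  `M`) is the `M∕K`-norm-class question of MECH-K2 §2 (frame letters `_c13 ∕ _c20`) — K5-C (2), not here.
WHAT IS NOT CLAIMED: that `e·x₀` generates a lattice of the SAME cell (the five `levelSet` clauses — K5-C (3)), the norm-class dichotomy, any count.
HONEST LABEL.  Count-neutral ring ∕ valuation algebra; nothing printed is asserted; no census law is stated; `HC_CM` is proved only modulo the 7 printed citations (2 remaining named
inputs: hLiu418 = `stmt-HodgeConjecture-24832`, h413 = `stmt-HodgeConjecture-24833`) until rung 0 closes.
## References
* [Jacobowitz1962] R. Jacobowitz, *Hermitian forms over local fields*, Amer. J. Math. 84 (1962): §4 (dual lattices, gluing).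
* [Kottwitz1986BaseChangeUnits] R. E. Kottwitz, *Base change for unit elements of Hecke algebras*, Compositio Math. 60 (1986): §1 pp. 240–241 (fixed-lattice counts).
* [Serre1979] J.-P. Serre, *Local Fields*, GTM 67 (1979): Ch. III §3 Prop. 7, §6 Prop. 12; Ch. V §2 Prop. 3; [Rogawski1990] J. D. Rogawski, *Automorphic Representations of Unitary
  Groups in Three Variables*, Ann. of Math. Stud. 123 (1990): §4.9 Prop. 4.9.1 (b) p. 55.
-/

set_option autoImplicit false

noncomputable section

namespace Summit.HodgeConjecture.HodgeConjecture.Cruxes.H413.F0P3cDyRamRowVertexCoordinateChange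

open scoped Valued WithZero
open WithZero
open Summit.HodgeConjecture.HodgeConjecture.Cruxes.H413.F0P3cDyRamToricCensusDefs

variable {E M : Type} [Field E] [Field M] [Valued M ℤᵐ⁰] {ρ Θ : M →+* M} {α : M}

/-! ## §1 The generator moves `Y` and `D₀` by a `Θ`-norm; the skew of a `Θ`-norm -/

omit [Valued M ℤᵐ⁰] in
/-- **`Y(e·x₀) = Y(x₀)·(eΘe)`** (`Y = dualGen ρ Θ α cc h x₀ = h·(x₀Θx₀)·cc(α − ρα)`). [cite: Jacobowitz1962, §4] -/
theorem dualGen_mul_gen (cc hM e x₀ : M) : dualGen ρ Θ α cc hM (e * x₀) = dualGen ρ Θ α cc hM x₀ * (e * Θ e) := by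
  rw [dualGen_def, dualGen_def, map_mul]; ring

omit [Valued M ℤᵐ⁰] in
/-- **`D₀(e·x₀) = D₀(x₀)·(eΘe)`** (`D₀ = cc(α − ρα)·ΘY`, `Θ² = 1`). [cite: Jacobowitz1962, §4] -/
theorem cellScalar_mul_gen (hΘΘ : ∀ x, Θ (Θ x) = x) (cc hM e x₀ : M) :
    cc * (α - ρ α) * Θ (dualGen ρ Θ α cc hM (e * x₀)) = cc * (α - ρ α) * Θ (dualGen ρ Θ α cc hM x₀) * (e * Θ e) := by
  rw [dualGen_mul_gen, map_mul, map_mul, hΘΘ]; ring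

omit [Valued M ℤᵐ⁰] in
/-- **THE SKEW OF A `Θ`-NORM**: `Θρ = ρΘ` ⟹ `ζΘζ − ρ(ζΘζ) = (ζ − ρζ)·Θζ + ρζ·Θ(ζ − ρζ)`. [cite: Serre1979, Ch. III §3 Prop. 7] -/
theorem normTheta_sub_map_eq (hΘρ : ∀ x, Θ (ρ x) = ρ (Θ x)) (ζ : M) :
    ζ * Θ ζ - ρ (ζ * Θ ζ) = (ζ - ρ ζ) * Θ ζ + ρ ζ * Θ (ζ - ρ ζ) := by
  rw [map_mul, ← hΘρ, map_sub]; ring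

/-- Hence `|ζΘζ − ρ(ζΘζ)| ≤ |ζ − ρζ|·|ζ|` (`ρ`, `Θ` isometric): an ORDER UNIT `ζ ∈ 𝒪_cc^×` has a `Θ`-norm that is `ρ`-fixed to the order's precision `|cc(α − ρα)|`.
[cite: Serre1979, Ch. III §6 Prop. 12] -/
theorem v_normTheta_sub_map_le (hvρ : ∀ x, Valued.v (ρ x) = Valued.v x) (hΘρ : ∀ x, Θ (ρ x) = ρ (Θ x)) (hvΘ : ∀ x, Valued.v (Θ x) = Valued.v x)
    (ζ : M) : Valued.v (ζ * Θ ζ - ρ (ζ * Θ ζ)) ≤ Valued.v (ζ - ρ ζ) * Valued.v ζ := by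
  rw [normTheta_sub_map_eq hΘρ]
  refine (Valuation.map_add _ _ _).trans (max_le ?_ ?_)
  · rw [Valuation.map_mul, hvΘ]
  · rw [Valuation.map_mul, hvρ, hvΘ, mul_comm]

/-! ## §2 The exact change of the trace-normalised point `κ̂ = w∕Tr_ρ w` under `w ↦ w·u` -/

omit [Valued M ℤᵐ⁰] in
/-- **`wu∕Tr_ρ(wu) − w∕Tr_ρ w = w·ρw·(u − ρu)∕(Tr_ρ w·Tr_ρ(wu))`** (both traces non-zero): the trace-normalised point moves by the SKEW of the multiplier.
[cite: Serre1979, Ch. III §3 Prop. 7] [cite: Jacobowitz1962, §4] -/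
theorem div_trace_mul_sub_div_trace {w u : M} (hT : w + ρ w ≠ 0) (hT' : w * u + ρ (w * u) ≠ 0) :
    w * u / (w * u + ρ (w * u)) - w / (w + ρ w) = w * ρ w * (u - ρ u) / ((w + ρ w) * (w * u + ρ (w * u))) := by
  have hT'' : w * u + ρ w * ρ u ≠ 0 := by rwa [map_mul] at hT'
  rw [map_mul]
  field_simp
  ring

omit [Valued M ℤᵐ⁰] in
/-- **THE COORDINATE MOVES BY THE SKEW**: if `w∕Tr_ρ w = κ₀ + jE(V)·ξ₀` and `wu∕Tr_ρ(wu) = κ₀ + jE(V′)·ξ₀` then `jE(V′ − V)·ξ₀ = w·ρw·(u − ρu)∕(Tr_ρ w·Tr_ρ(wu))`.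
[cite: Serre1979, Ch. III §6 Prop. 12] [cite: Jacobowitz1962, §4] -/
theorem map_sub_mul_anti_eq (jE : E →+* M) {w u κ₀ ξ₀ : M} {V V' : E} (hT : w + ρ w ≠ 0) (hT' : w * u + ρ (w * u) ≠ 0)
    (hκ : w / (w + ρ w) = κ₀ + jE V * ξ₀) (hκ' : w * u / (w * u + ρ (w * u)) = κ₀ + jE V' * ξ₀) :
    jE (V' - V) * ξ₀ = w * ρ w * (u - ρ u) / ((w + ρ w) * (w * u + ρ (w * u))) := by
  rw [← div_trace_mul_sub_div_trace hT hT', hκ, hκ', map_sub]; ring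

/-- Its valuation: `|jE(V′ − V)|·|ξ₀| = |w|²·|u − ρu|∕(|Tr_ρ w|·|Tr_ρ(wu)|)`. [cite: Serre1979, Ch. III §6 Prop. 12] -/
theorem v_map_sub_mul_eq (hvρ : ∀ x, Valued.v (ρ x) = Valued.v x) (jE : E →+* M) {w u κ₀ ξ₀ : M} {V V' : E}
    (hT : w + ρ w ≠ 0) (hT' : w * u + ρ (w * u) ≠ 0)
    (hκ : w / (w + ρ w) = κ₀ + jE V * ξ₀) (hκ' : w * u / (w * u + ρ (w * u)) = κ₀ + jE V' * ξ₀) :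
    Valued.v (jE (V' - V)) * Valued.v ξ₀ = Valued.v w ^ 2 * Valued.v (u - ρ u) / (Valued.v (w + ρ w) * Valued.v (w * u + ρ (w * u))) := by
  rw [← Valuation.map_mul, map_sub_mul_anti_eq jE hT hT' hκ hκ', map_div₀, Valuation.map_mul, Valuation.map_mul, Valuation.map_mul, hvρ, pow_two]

omit [Valued M ℤᵐ⁰] in
/-- ★ p862871's point IS `w∕Tr_ρ w`: `D₀⁻¹ + ρD₀⁻¹ = jE pw` ⟹ `D₀⁻¹·(jE pw)⁻¹ = D₀⁻¹∕(D₀⁻¹ + ρD₀⁻¹)`. [cite: Jacobowitz1962, §4] -/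
theorem inv_mul_inv_eq_div_trace (jE : E →+* M) {D₀ : M} {pw : E} (hTr : D₀⁻¹ + ρ D₀⁻¹ = jE pw) :
    D₀⁻¹ * (jE pw)⁻¹ = D₀⁻¹ / (D₀⁻¹ + ρ D₀⁻¹) := by
  rw [hTr, div_eq_mul_inv]

omit [Valued M ℤᵐ⁰] in
/-- The new cell scalar's inverse is the old one times `u = (eΘe)⁻¹`: `(D₀·(eΘe))⁻¹ = D₀⁻¹·(eΘe)⁻¹`. [cite: Jacobowitz1962, §4] -/
theorem inv_cellScalar_mul_gen (D₀ e : M) : (D₀ * (e * Θ e))⁻¹ = D₀⁻¹ * (e * Θ e)⁻¹ := by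
  rw [mul_inv]

/-! ## §3 Generator independence: an order unit moves the coordinate below the cell's digit -/

/-- **GENERATOR INDEPENDENCE OF THE DIGIT.**  Same lattice, other generator `ζ·x₀` with `ζ ∈ 𝒪_cc` (`IsOrd ρ α cc ζ`) a unit: the multiplier `u = (ζΘζ)⁻¹` is a `Θ`-fixed unit with
`|u − ρu| ≤ |cc(α − ρα)|` (§1), so `|jE(V′ − V)|·|ξ₀| ≤ |w|²·|cc(α − ρα)|∕(|Tr_ρ w|·|Tr_ρ(wu)|)` — in the row tokens (`|w| = |D₀|⁻¹ = |jEϖ|^{−(j+b)}|α − ρα|⁻¹`,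
`|Tr_ρ w| = |Tr_ρ(wu)| = |jE pw| = |jEϖ|^{−2b}`, `|cc| = |jEϖ|^j`) this is `|jEϖ|^{b − (j − b)}·|α − ρα|⁻¹`, i.e. `|jEϖ|^{b}` BELOW the size `|jEϖ|^{−(j−b)}|α − ρα|⁻¹` of `κ̂` itself:
the digit of `V(Λ)` is the lattice's, not the generator's. [cite: Serre1979, Ch. III §6 Prop. 12] [cite: Kottwitz1986BaseChangeUnits, §1 pp. 240–241] -/
theorem v_map_sub_mul_le_of_orderUnit (hvρ : ∀ x, Valued.v (ρ x) = Valued.v x) (hΘρ : ∀ x, Θ (ρ x) = ρ (Θ x)) (hvΘ : ∀ x, Valued.v (Θ x) = Valued.v x)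
    (jE : E →+* M) {cc ζ w κ₀ ξ₀ : M} {V V' : E} (hζ : IsOrd ρ α cc ζ) (hζ1 : Valued.v ζ = 1)
    (hT : w + ρ w ≠ 0) (hT' : w * (ζ * Θ ζ)⁻¹ + ρ (w * (ζ * Θ ζ)⁻¹) ≠ 0)
    (hκ : w / (w + ρ w) = κ₀ + jE V * ξ₀) (hκ' : w * (ζ * Θ ζ)⁻¹ / (w * (ζ * Θ ζ)⁻¹ + ρ (w * (ζ * Θ ζ)⁻¹)) = κ₀ + jE V' * ξ₀) :
    Valued.v (jE (V' - V)) * Valued.v ξ₀ ≤ Valued.v w ^ 2 * Valued.v (cc * (α - ρ α)) / (Valued.v (w + ρ w) * Valued.v (w * (ζ * Θ ζ)⁻¹ + ρ (w * (ζ * Θ ζ)⁻¹))) := by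
  rw [v_map_sub_mul_eq hvρ jE hT hT' hκ hκ']
  set N : M := ζ * Θ ζ with hNdef
  have hN1 : Valued.v N = 1 := by rw [hNdef, Valuation.map_mul, hvΘ, hζ1, mul_one]
  have hN0 : N ≠ 0 := fun h0 => by rw [h0, map_zero] at hN1; exact zero_ne_one hN1
  -- `|u − ρu| = |N − ρN|` for the unit `N = ζΘζ`, `u = N⁻¹`
  have hu : Valued.v (N⁻¹ - ρ N⁻¹) = Valued.v (N - ρ N) := by
    have hρN0 : ρ N ≠ 0 := (map_ne_zero ρ).2 hN0
    have e : N⁻¹ - ρ N⁻¹ = -(N - ρ N) / (N * ρ N) := by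
      rw [map_inv₀]; field_simp; ring
    rw [e, map_div₀, Valuation.map_neg, Valuation.map_mul, hvρ, hN1, mul_one, div_one]
  have hle : Valued.v (N⁻¹ - ρ N⁻¹) ≤ Valued.v (cc * (α - ρ α)) := by
    rw [hu, hNdef]; exact (v_normTheta_sub_map_le hvρ hΘρ hvΘ ζ).trans (by rw [hζ1, mul_one]; exact hζ.2)
  rw [div_eq_mul_inv, div_eq_mul_inv]
  exact mul_le_mul' (mul_le_mul' le_rfl hle) le_rfl

/-! ## §4 Transport: the multiplier that lands exactly on a prescribed digit -/

omit [Valued M ℤᵐ⁰] in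
/-- **A POINT OF THE LINE HAS ρ-TRACE ONE**: `Tr_ρ κ₀ = 1`, `ρξ₀ = −ξ₀`, `ρ(jE V) = jE V` ⟹ `Tr_ρ(κ₀ + jE(V)·ξ₀) = 1`. [cite: Serre1979, Ch. III §6 Prop. 12] -/
theorem trace_affinePoint_eq_one (jE : E →+* M) {κ₀ ξ₀ : M} {V : E} (hκ₀ : κ₀ + ρ κ₀ = 1) (hξ : ρ ξ₀ = -ξ₀) (hV : ρ (jE V) = jE V) :
    (κ₀ + jE V * ξ₀) + ρ (κ₀ + jE V * ξ₀) = 1 := by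
  rw [map_add, map_mul, hV, hξ]; linear_combination hκ₀

omit [Valued M ℤᵐ⁰] in
/-- **`(κ·c)∕Tr_ρ(κ·c) = κ`** for `Tr_ρ κ = 1` and a ρ-fixed `c ≠ 0`: scaling by `Fix ρ` does not move the trace-normalised point. [cite: Serre1979, Ch. III §3 Prop. 7] -/
theorem div_trace_eq_of_trace_one {κ c : M} (hκ : κ + ρ κ = 1) (hc : ρ c = c) (hc0 : c ≠ 0) : κ * c / (κ * c + ρ (κ * c)) = κ := by
  rw [map_mul, hc, ← add_mul, hκ, one_mul, mul_div_cancel_right₀ _ hc0]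

omit [Valued M ℤᵐ⁰] in
/-- **THE TRANSPORT MULTIPLIER**: for `w ≠ 0`, a ρ-fixed `c ≠ 0` and a target digit `V₂` (`ρ(jE V₂) = jE V₂`), the multiplier `u := (κ₀ + jE V₂ ξ₀)·c∕w` gives
`wu∕Tr_ρ(wu) = κ₀ + jE(V₂)·ξ₀` EXACTLY; `u⁻¹ = eΘe` for some `e` (then `e·x₀` realises it, §1) iff `u` is in the `Θ`-norm class — the frame's dichotomy `_c13`, K5-C (2).
[cite: Jacobowitz1962, §4] [cite: Serre1979, Ch. V §2 Prop. 3] -/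
theorem div_trace_transport_eq (jE : E →+* M) {w c κ₀ ξ₀ : M} {V₂ : E} (hw : w ≠ 0) (hc : ρ c = c) (hc0 : c ≠ 0)
    (hκ₀ : κ₀ + ρ κ₀ = 1) (hξ : ρ ξ₀ = -ξ₀) (hV : ρ (jE V₂) = jE V₂) :
    w * ((κ₀ + jE V₂ * ξ₀) * c / w) / (w * ((κ₀ + jE V₂ * ξ₀) * c / w) + ρ (w * ((κ₀ + jE V₂ * ξ₀) * c / w))) = κ₀ + jE V₂ * ξ₀ := by
  rw [mul_div_cancel₀ _ hw]
  exact div_trace_eq_of_trace_one (trace_affinePoint_eq_one jE hκ₀ hξ hV) hc hc0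

end Summit.HodgeConjecture.HodgeConjecture.Cruxes.H413.F0P3cDyRamRowVertexCoordinateChange

end
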